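import Summits.BirchSwinnertonDyer.BirchSwinnertonDyer.Theorems.ManinLocalTwoThreeShimuraTrivialThirtySix
import Summits.BirchSwinnertonDyer.BirchSwinnertonDyer.Theorems.ManinLocalTwoThreeShimuraQuotientLevelInstances
import Literature.NumberTheory.EllipticCurves.ShimuraSubgroupEisensteinProofs
import Literature.NumberTheory.EllipticCurves.ShimuraSubgroupHeckeCongruence
import HarnessLib

/-!
# SHIMURA COVERING CLASSES ARE EISENSTEIN, and the MOD-`2` SEPARATION CRITERION at genus `> 1` (FACT-FREE)
Summit `BirchSwinnertonDyer`, route `ManinLocalTwoThree` (cell bsd-f2-manin, es lens, gen 45, turnkey T-es-106; CANDIDATES row E-es-254/255),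
crux C2 `ManinOddAtFour` (stmt-BirchSwinnertonDyer-22967).  Sequel to `…ShimuraClasses` (T-es-102: the covering classes
`φ_χ : H₁(X₀(N), ℤ) → R`, `φ_χ({∞, k∞}) = χ(d_k)`), `…ShimuraTrivialThirtySix` §3 (T-es-105: descent by the PERIOD KERNEL
`K_f = {x ∈ H₁ : x(f) = 0}` — `f` sees `φ` as soon as `φ(K_f) = 0`) and the Literature file `ShimuraSubgroupEisensteinProofs`
(`(a_ℓ − ℓ − 1)Λ₀(f) ⊆ Λ₁(f)`, the UPPER-bound side).  This file is the LOWER-bound side at levels of genus `> 1`, where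
`S₂(Γ₀(N)) ≠ ℂ·f` and the dimension-one descent of T-es-102/104 is unavailable.

* §1 CLASS CALCULUS.  For ANY additive `φ : periodHomology N →+ R` vanishing on the `Γ₁(N)`-periods, the generator values
  `v(k) = φ({∞, k∞})` are a homomorphism on `Γ₀(N)` that only depends on `d_k mod N` (`value_mul`, `value_eq_of_apply_one_one_eq`, …).
* §2 **THEOREM A — SHIMURA CLASSES ARE EISENSTEIN** (`value_dualMap_heckeT`): for a prime `ℓ ∤ N` and every `x ∈ H₁(X₀(N), ℤ)`,
  **`φ(T_ℓ^∨ x) = (ℓ + 1)·φ(x)`** — Ribet's «`Σ(N)` is Eisenstein» read on covering classes, for all `φ` as in §1 at once.  Proof: the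
  `ℓ + 1` Hecke cusps of `{∞, γ∞}` are `{∞, δ∞}` for `δ ∈ Γ₀(N)` of class `d_γ` (`ℓ − 1` or `ℓ + 1` of them) or of the two classes
  `ℓ^{±1} d_γ` (tree `exists_gamma0_tpB_col` / `exists_gamma0_tpD_col`), and `χ(ℓ d) + χ(ℓ⁻¹ d) = 2χ(d)`.
* §3 **EISENSTEIN-TRANSPARENT OPERATORS** (`t^∨` preserves `H₁` and `φ ∘ t^∨ = u·φ`): `T_ℓ − c` is transparent
  with `u = ℓ + 1 − c` (`transparent_heckeT_sub`), and transparency composes with `u`'s multiplying (`transparent_comp`).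
* §4 **THEOREM B — THE SEPARATION CRITERION** (`ker_of_transparent_separator`): if a transparent `t` with `u` injective on `R`
  SEPARATES `f` (`t·S₂(Γ₀(N)) ⊆ ℂ·f`), then `φ` kills the period kernel `K_f`; hence (`…_not_mem_…`, T-es-105 §3)
  `n·v(γ) ≠ 0 ⇒ n·{∞, γ∞}_f ∉ Λ₁(f)`, and at `4 ∣ N` (`2Λ₀ ⊆ Λ₁` for data, tree `two_mul_mem_periodLatticeGamma1_of_four_dvd`)
  **`¬ ShimuraIndexPrimeTo 2 D.f`** (`not_shimuraIndexPrimeTo_two_of_data`).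
* The sequel `…ShimuraEisensteinFiftyTwo.lean` runs the criterion at the genus-`5` level `52 = 4·13` (class `φ₁₃`, separator
  `(T₃ − 1)(T₃ + 3)`, multiplier `21`): E-es-254 `¬ ShimuraIndexPrimeTo 2 D.f` from the X₀(52) Hecke datum.

All theorems are kernel-checked with the standard axioms; no Literature fact (`def … : Prop`) is consumed.  Beyond print: NO (Ribet 1988,
Ling–Oesterlé 1991); new in the tree: the first genus-`> 1` LOWER-bound mechanism for the Shimura index `[Λ₀(f) : Λ₁(f)]`.

References: [Ribet1988Shimura] Thm. 1, §3; [LingOesterle1991] §1, Thm. 1; [Mazur1977] §II.9–II.11; [CremonaAlgorithms1997] §2.4, Tables 3, 5;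
[Stevens1989] §2.
-/

set_option autoImplicit false

noncomputable section

-- justification: the `Summit.BirchSwinnertonDyer.BirchSwinnertonDyer.…` path repeats a component (route-file convention)
set_option linter.dupNamespace false

open scoped Classical MatrixGroups

open CongruenceSubgroup Matrix.SpecialLinearGroup ModularGroup
open Literature.NumberTheory.EllipticCurves.ModularForms
open Summit.BirchSwinnertonDyer.BirchSwinnertonDyer.Theorems.ManinLocalTwoThree.ShimuraClass
open Summit.BirchSwinnertonDyer.BirchSwinnertonDyer.Theorems.ManinLocalTwoThree.ShimuraThirtySix
  (zsmul_cuspSymbol_not_mem_of_hom_of_ker)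
open Summit.BirchSwinnertonDyer.Rank1Residual.ManinAdditive.KatoCurve (ShimuraIndexPrimeTo)

namespace Summit.BirchSwinnertonDyer.BirchSwinnertonDyer.Theorems.ManinLocalTwoThree.ShimuraEisenstein

variable {N : ℕ} [NeZero N] {R : Type} [AddCommGroup R]
variable (φ : periodHomology N →+ R) (v : Gamma0 N → R)
  (hφ : ∀ k : Gamma0 N, φ ⟨periodFunctional N k, periodFunctional_mem_periodHomology N k⟩ = v k)
  (hv : ∀ γ₁ : Gamma1 N, v ⟨(γ₁ : SL(2, ℤ)), Gamma1_in_Gamma0 N γ₁.2⟩ = 0)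

/-! ## §1. Class calculus of a covering class -/

include hφ in
/-- The generator values of an additive class on `H₁(X₀(N), ℤ)` are a homomorphism on `Γ₀(N)` (Manin). [cite: Manin1972, Prop. 1.4] -/
theorem value_mul (γ δ : Gamma0 N) : v (γ * δ) = v γ + v δ := by
  rw [← hφ, ← hφ, ← hφ, ← map_add]
  congr 1
  exact Subtype.ext (periodFunctional_mul N γ δ)

include hφ hv in
/-- A class vanishing on `Γ₁(N)` only depends on `d mod N`. [cite: DiamondShurman2005, §1.2] -/
theorem value_eq_of_apply_one_one_eq (γ δ : Gamma0 N)
    (hd : ((((γ : SL(2, ℤ)) 1 1 : ℤ) : ZMod N)) = (((δ : SL(2, ℤ)) 1 1 : ℤ) : ZMod N)) : v δ = v γ := by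
  have hmem : (γ : SL(2, ℤ))⁻¹ * (δ : SL(2, ℤ)) ∈ Gamma1 N := inv_mul_mem_Gamma1_of_entry_eq γ.2 δ.2 hd
  set ε : Gamma0 N := ⟨(γ : SL(2, ℤ))⁻¹ * (δ : SL(2, ℤ)), Gamma1_in_Gamma0 N hmem⟩ with hε
  have hγε : γ * ε = δ := Subtype.ext (mul_inv_cancel_left (γ : SL(2, ℤ)) (δ : SL(2, ℤ)))
  rw [← hγε, value_mul φ v hφ, show v ε = 0 from hv ⟨_, hmem⟩, add_zero]

include hφ hv in
/-- … equivalently on `a mod N` (`a d ≡ 1`). [cite: DiamondShurman2005, §1.2] -/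
theorem value_eq_of_apply_zero_zero_eq (γ δ : Gamma0 N)
    (ha : (((δ : SL(2, ℤ)) 0 0 : ℤ) : ZMod N) = (((γ : SL(2, ℤ)) 0 0 : ℤ) : ZMod N)) : v δ = v γ := by
  refine value_eq_of_apply_one_one_eq φ v hφ hv γ δ ?_
  have hγ := apply_zero_zero_mul_apply_one_one γ
  have hδ := apply_zero_zero_mul_apply_one_one δ
  rw [ha] at hδ
  calc (((γ : SL(2, ℤ)) 1 1 : ℤ) : ZMod N)
      = (((γ : SL(2, ℤ)) 1 1 : ℤ) : ZMod N) * ((((γ : SL(2, ℤ)) 0 0 : ℤ) : ZMod N) *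
          (((δ : SL(2, ℤ)) 1 1 : ℤ) : ZMod N)) := by rw [hδ, mul_one]
    _ = ((((γ : SL(2, ℤ)) 0 0 : ℤ) : ZMod N) * (((γ : SL(2, ℤ)) 1 1 : ℤ) : ZMod N)) *
          (((δ : SL(2, ℤ)) 1 1 : ℤ) : ZMod N) := by ring
    _ = _ := by rw [hγ, one_mul]

include hφ hv in
/-- `v(δ) = v(γ) + v(κ)` when `ℓ·a_δ ≡ a_γ` and `d_κ ≡ ℓ` (`d_δ ≡ d_γ d_κ`). [cite: Stevens1989, §2] -/
theorem value_eq_add_of_mul_apply_zero_zero_eq (γ δ κ : Gamma0 N) {ℓ : ZMod N}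
    (hκ : (((κ : SL(2, ℤ)) 1 1 : ℤ) : ZMod N) = ℓ)
    (ha : ℓ * (((δ : SL(2, ℤ)) 0 0 : ℤ) : ZMod N) = (((γ : SL(2, ℤ)) 0 0 : ℤ) : ZMod N)) : v δ = v γ + v κ := by
  rw [← value_mul φ v hφ γ κ]
  refine value_eq_of_apply_one_one_eq φ v hφ hv (γ * κ) δ ?_
  rw [apply_one_one_mul_eq, hκ]
  have hγ := apply_zero_zero_mul_apply_one_one γ
  have hδ := apply_zero_zero_mul_apply_one_one δ
  calc (((γ : SL(2, ℤ)) 1 1 : ℤ) : ZMod N) * ℓ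
      = (((γ : SL(2, ℤ)) 1 1 : ℤ) : ZMod N) * ℓ *
          ((((δ : SL(2, ℤ)) 0 0 : ℤ) : ZMod N) * (((δ : SL(2, ℤ)) 1 1 : ℤ) : ZMod N)) := by rw [hδ, mul_one]
    _ = (ℓ * (((δ : SL(2, ℤ)) 0 0 : ℤ) : ZMod N)) * (((γ : SL(2, ℤ)) 1 1 : ℤ) : ZMod N) *
          (((δ : SL(2, ℤ)) 1 1 : ℤ) : ZMod N) := by ring
    _ = (((δ : SL(2, ℤ)) 1 1 : ℤ) : ZMod N) := by rw [ha, hγ, one_mul]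

include hφ hv in
/-- `v(δ) + v(κ) = v(γ)` when `a_δ ≡ ℓ·a_γ` and `d_κ ≡ ℓ` (`d_δ d_κ ≡ d_γ`). [cite: Stevens1989, §2] -/
theorem value_add_eq_of_apply_zero_zero_eq_mul (γ δ κ : Gamma0 N) {ℓ : ZMod N}
    (hκ : (((κ : SL(2, ℤ)) 1 1 : ℤ) : ZMod N) = ℓ)
    (ha : (((δ : SL(2, ℤ)) 0 0 : ℤ) : ZMod N) = ℓ * (((γ : SL(2, ℤ)) 0 0 : ℤ) : ZMod N)) : v δ + v κ = v γ := by
  rw [← value_mul φ v hφ δ κ]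
  refine value_eq_of_apply_one_one_eq φ v hφ hv γ (δ * κ) ?_
  rw [apply_one_one_mul_eq, hκ]
  have hγ := apply_zero_zero_mul_apply_one_one γ
  have hδ := apply_zero_zero_mul_apply_one_one δ
  rw [ha] at hδ
  calc (((γ : SL(2, ℤ)) 1 1 : ℤ) : ZMod N)
      = (((γ : SL(2, ℤ)) 1 1 : ℤ) : ZMod N) *
          (ℓ * (((γ : SL(2, ℤ)) 0 0 : ℤ) : ZMod N) * (((δ : SL(2, ℤ)) 1 1 : ℤ) : ZMod N)) := by rw [hδ, mul_one]
    _ = ((((γ : SL(2, ℤ)) 0 0 : ℤ) : ZMod N) * (((γ : SL(2, ℤ)) 1 1 : ℤ) : ZMod N)) *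
          ((((δ : SL(2, ℤ)) 1 1 : ℤ) : ZMod N) * ℓ) := by ring
    _ = (((δ : SL(2, ℤ)) 1 1 : ℤ) : ZMod N) * ℓ := by rw [hγ, one_mul]

/-! ## §2. THEOREM A: covering classes are Eisenstein — `φ(T_ℓ^∨ x) = (ℓ + 1)·φ(x)` for `ℓ ∤ N` -/

/-- For `ℓ` prime, `ℓ ∤ c`: some `j ∈ [0, ℓ)` has `ℓ ∣ a + jc`. [folklore] -/
private theorem exists_fin_dvd_add_mul {ℓ : ℕ} (hℓ : ℓ.Prime) {a c : ℤ} (hc : ¬ (ℓ : ℤ) ∣ c) :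
    ∃ j₀ : Fin ℓ, (ℓ : ℤ) ∣ a + ((j₀ : ℕ) : ℤ) * c := by
  haveI : Fact ℓ.Prime := ⟨hℓ⟩
  have hcℓ : ((c : ℤ) : ZMod ℓ) ≠ 0 := by
    rwa [Ne, ZMod.intCast_zmod_eq_zero_iff_dvd]
  set x : ZMod ℓ := -(a : ZMod ℓ) * ((c : ℤ) : ZMod ℓ)⁻¹ with hx
  refine ⟨⟨x.val, x.val_lt⟩, ?_⟩
  rw [← ZMod.intCast_zmod_eq_zero_iff_dvd]
  push_cast
  rw [ZMod.natCast_zmod_val, hx]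
  field_simp
  ring

/-- … and it is unique. [folklore] -/
private theorem fin_eq_of_dvd_add_mul {ℓ : ℕ} (hℓ : ℓ.Prime) {a c : ℤ} (hc : ¬ (ℓ : ℤ) ∣ c) {j j' : Fin ℓ}
    (hj : (ℓ : ℤ) ∣ a + ((j : ℕ) : ℤ) * c) (hj' : (ℓ : ℤ) ∣ a + ((j' : ℕ) : ℤ) * c) : j = j' := by
  haveI : Fact ℓ.Prime := ⟨hℓ⟩
  have hℓP : Prime (ℓ : ℤ) := Nat.prime_iff_prime_int.mp hℓ
  have hsub : (ℓ : ℤ) ∣ (((j : ℕ) : ℤ) - ((j' : ℕ) : ℤ)) * c := by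
    have h := dvd_sub hj hj'
    have e : a + ((j : ℕ) : ℤ) * c - (a + ((j' : ℕ) : ℤ) * c) = (((j : ℕ) : ℤ) - ((j' : ℕ) : ℤ)) * c := by ring
    rwa [e] at h
  have hjj : (ℓ : ℤ) ∣ ((j : ℕ) : ℤ) - ((j' : ℕ) : ℤ) := (hℓP.dvd_or_dvd hsub).resolve_right hc
  have hmod : ((j : ℕ) : ZMod ℓ) = ((j' : ℕ) : ZMod ℓ) := by
    have h := (ZMod.intCast_zmod_eq_zero_iff_dvd _ ℓ).mpr hjj
    push_cast at h
    exact sub_eq_zero.mp h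
  rw [ZMod.natCast_eq_natCast_iff, Nat.ModEq, Nat.mod_eq_of_lt j.isLt, Nat.mod_eq_of_lt j'.isLt] at hmod
  exact Fin.ext hmod

/-- **The transpose Hecke operator on a period functional, with the classes of the Hecke cusps.**  For `ℓ ∤ N` prime and `γ ∈ Γ₀(N)`:
`T_ℓ^∨(h ↦ {∞, γ∞}_h) = ∑ⱼ (h ↦ {∞, δⱼ∞}_h) + (h ↦ {∞, δ'∞}_h)` with the `δⱼ, δ'` of `exists_gamma0_tpB_col` / `exists_gamma0_tpD_col`
(Cremona (2.4.1)–(2.4.2) on closed paths). [cite: CremonaAlgorithms1997, §2.4 (2.4.1)–(2.4.2)] -/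
theorem dualMap_heckeT_periodFunctional_eq {ℓ : ℕ} [NeZero ℓ] (hℓ : ℓ.Prime) (hℓN : ¬ ℓ ∣ N) (γ : Gamma0 N)
    (δ : Fin ℓ → Gamma0 N) (δD : Gamma0 N)
    (hδc : ∀ j, ((δ j : SL(2, ℤ)) 1 0 = 0 ↔ (γ : SL(2, ℤ)) 1 0 = 0))
    (hδv : ∀ j, (γ : SL(2, ℤ)) 1 0 ≠ 0 → ((δ j : SL(2, ℤ)) 0 0 : ℚ) / ((δ j : SL(2, ℤ)) 1 0 : ℚ) =
      (((γ : SL(2, ℤ)) 0 0 : ℚ) / ((γ : SL(2, ℤ)) 1 0 : ℚ) + ((j : ℕ) : ℤ)) / ℓ)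
    (hDc : ((δD : SL(2, ℤ)) 1 0 = 0 ↔ (γ : SL(2, ℤ)) 1 0 = 0))
    (hDv : (γ : SL(2, ℤ)) 1 0 ≠ 0 → ((δD : SL(2, ℤ)) 0 0 : ℚ) / ((δD : SL(2, ℤ)) 1 0 : ℚ) =
      ℓ * (((γ : SL(2, ℤ)) 0 0 : ℚ) / ((γ : SL(2, ℤ)) 1 0 : ℚ))) :
    (heckeT (Gamma0 N) 2 ℓ).dualMap (periodFunctional N γ) =
      ∑ j : Fin ℓ, periodFunctional N (δ j) + periodFunctional N δD := by
  refine LinearMap.ext fun h ↦ ?_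
  rw [LinearMap.dualMap_apply, periodFunctional_apply, LinearMap.add_apply, LinearMap.sum_apply]
  simp only [periodFunctional_apply]
  by_cases hc : (γ : SL(2, ℤ)) 1 0 = 0
  · rw [cuspSymbol, if_pos hc, cuspSymbol, if_pos (hDc.mpr hc), add_zero]
    symm
    exact Finset.sum_eq_zero fun j _ ↦ by rw [cuspSymbol, if_pos ((hδc j).mpr hc)]
  · rw [cuspSymbol, if_neg hc, modularSymbol_heckeT_eq_sum ℓ h hℓ, if_neg hℓN]
    congr 1
    · refine Finset.sum_congr rfl fun j _ ↦ ?_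
      rw [cuspSymbol, if_neg (fun h0 ↦ hc ((hδc j).mp h0)), hδv j hc]
    · rw [cuspSymbol, if_neg (fun h0 ↦ hc (hDc.mp h0)), hDv hc]

include hφ hv in
/-- **THEOREM A on generators**: `φ(T_ℓ^∨{∞, γ∞}) = (ℓ + 1)·v(γ)` for `ℓ ∤ N` prime — the classes of the `ℓ + 1` Hecke cusps are
`d_γ` (all of them if `ℓ ∣ c_γ`; all but two otherwise, the two being `ℓ^{±1}·d_γ`). [cite: Ribet1988Shimura, Thm. 1 and §3] -/
theorem value_dualMap_heckeT_periodFunctional {ℓ : ℕ} [NeZero ℓ] (hℓ : ℓ.Prime) (hℓN : ¬ ℓ ∣ N) (γ : Gamma0 N)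
    (hmem : (heckeT (Gamma0 N) 2 ℓ).dualMap (periodFunctional N γ) ∈ periodHomology N) :
    φ ⟨(heckeT (Gamma0 N) 2 ℓ).dualMap (periodFunctional N γ), hmem⟩ = (ℓ + 1) • v γ := by
  choose δ hδc hδv hδa hδa' using fun j : Fin ℓ ↦ exists_gamma0_tpB_col (N := N) hℓ γ ((j : ℕ) : ℤ)
  obtain ⟨δD, hDc, hDv, hDa, hDa'⟩ := exists_gamma0_tpD_col (N := N) hℓ hℓN γ
  have hT := dualMap_heckeT_periodFunctional_eq hℓ hℓN γ δ δD hδc hδv hDc hDv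
  -- `φ(T_ℓ^∨{∞, γ∞}) = ∑ⱼ v(δⱼ) + v(δ')`
  have hsub : (⟨(heckeT (Gamma0 N) 2 ℓ).dualMap (periodFunctional N γ), hmem⟩ : periodHomology N) =
      ∑ j : Fin ℓ, ⟨periodFunctional N (δ j), periodFunctional_mem_periodHomology N (δ j)⟩ +
        ⟨periodFunctional N δD, periodFunctional_mem_periodHomology N δD⟩ :=
    Subtype.ext (by rw [AddMemClass.coe_add, AddSubmonoidClass.coe_finsetSum]; exact hT)
  rw [hsub, map_add, map_sum]
  simp only [hφ]
  -- an element of class `ℓ`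
  have hℓu : IsUnit (ℓ : ZMod N) := by
    rw [← ZMod.coe_unitOfCoprime ℓ ((Nat.Prime.coprime_iff_not_dvd hℓ).mpr hℓN)]
    exact Units.isUnit _
  obtain ⟨κ, hκ⟩ := exists_gamma0_apply_one_one_eq_of_isUnit hℓu
  by_cases hℓc : (ℓ : ℤ) ∣ (γ : SL(2, ℤ)) 1 0
  · -- `ℓ ∣ c`: every Hecke cusp has the class of `γ`
    have hj : ∀ j : Fin ℓ, v (δ j) = v γ := by
      intro j
      refine value_eq_of_apply_zero_zero_eq φ v hφ hv γ (δ j) (hδa j fun h ↦ ?_)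
      have hℓa : (ℓ : ℤ) ∣ (γ : SL(2, ℤ)) 0 0 := by
        have := dvd_sub h (hℓc.mul_left ((j : ℕ) : ℤ))
        simpa using this
      have hcop : IsCoprime ((γ : SL(2, ℤ)) 0 0) ((γ : SL(2, ℤ)) 1 0) :=
        Matrix.SpecialLinearGroup.isCoprime_col (γ : SL(2, ℤ)) 0
      exact (Nat.prime_iff_prime_int.mp hℓ).not_unit (hcop.isUnit_of_dvd' hℓa hℓc)
    have hD : v δD = v γ := value_eq_of_apply_zero_zero_eq φ v hφ hv γ δD (hDa hℓc)
    simp only [hj, hD, Finset.sum_const, Finset.card_univ, Fintype.card_fin, add_nsmul, one_nsmul]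
  · -- `ℓ ∤ c`: the exceptional `j₀` (class `ℓ⁻¹ d_γ`… i.e. `v γ + v κ`) and the last cusp (`v γ − v κ`) compensate
    obtain ⟨j₀, hj₀⟩ := exists_fin_dvd_add_mul hℓ (a := (γ : SL(2, ℤ)) 0 0) hℓc
    have hj : ∀ j : Fin ℓ, j ≠ j₀ → v (δ j) = v γ := by
      intro j hne
      refine value_eq_of_apply_zero_zero_eq φ v hφ hv γ (δ j) (hδa j fun h ↦ ?_)
      exact hne (fin_eq_of_dvd_add_mul hℓ hℓc h hj₀)
    have hj₀' : v (δ j₀) = v γ + v κ :=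
      value_eq_add_of_mul_apply_zero_zero_eq φ v hφ hv γ (δ j₀) κ hκ (hδa' j₀ hj₀)
    have hD : v δD + v κ = v γ := value_add_eq_of_apply_zero_zero_eq_mul φ v hφ hv γ δD κ hκ (hDa' hℓc)
    have hsum1 : ∑ j : Fin ℓ, v (δ j) = ∑ j : Fin ℓ, (v γ + if j = j₀ then v κ else 0) :=
      Finset.sum_congr rfl fun j _ ↦ by
        by_cases h : j = j₀
        · rw [if_pos h, h, hj₀']
        · rw [if_neg h, hj j h, add_zero]
    rw [hsum1, Finset.sum_add_distrib, Finset.sum_const, Finset.card_univ, Fintype.card_fin, Finset.sum_ite_eq',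
      if_pos (Finset.mem_univ _), add_nsmul, one_nsmul, ← hD]
    abel

include hφ hv in
/-- **THEOREM A — COVERING CLASSES ARE EISENSTEIN.**  For every additive `φ : H₁(X₀(N), ℤ) → R` vanishing on the `Γ₁(N)`-periods,
every prime `ℓ ∤ N` and every `x ∈ H₁(X₀(N), ℤ)`: **`φ(T_ℓ^∨ x) = (ℓ + 1)·φ(x)`** (`T_ℓ^∨ x ∈ H₁` by the tree's
`dualMap_heckeT_mem_periodHomology`).  Ribet: the Shimura subgroup is Eisenstein. [cite: Ribet1988Shimura, Thm. 1 and §3]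
[cite: LingOesterle1991, §1] -/
theorem value_dualMap_heckeT {ℓ : ℕ} [NeZero ℓ] (hℓ : ℓ.Prime) (hℓN : ¬ ℓ ∣ N)
    (x : Module.Dual ℂ (CuspForm (Gamma0 N) 2)) (hx : x ∈ periodHomology N) :
    φ ⟨(heckeT (Gamma0 N) 2 ℓ).dualMap x, dualMap_heckeT_mem_periodHomology N hℓ hx⟩ = (ℓ + 1) • φ ⟨x, hx⟩ := by
  induction hx using AddSubgroup.closure_induction with
  | mem y hy =>
    obtain ⟨γ, rfl⟩ := hy
    rw [hφ]
    exact value_dualMap_heckeT_periodFunctional φ v hφ hv hℓ hℓN γ _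
  | zero =>
    have h0 : (⟨(heckeT (Gamma0 N) 2 ℓ).dualMap 0, dualMap_heckeT_mem_periodHomology N hℓ (zero_mem _)⟩ :
        periodHomology N) = 0 := Subtype.ext (map_zero _)
    rw [h0, map_zero, show (⟨(0 : Module.Dual ℂ (CuspForm (Gamma0 N) 2)), zero_mem _⟩ : periodHomology N) = 0 from rfl,
      map_zero, nsmul_zero]
  | add y z hy hz ihy ihz =>
    have h0 : (⟨(heckeT (Gamma0 N) 2 ℓ).dualMap (y + z), dualMap_heckeT_mem_periodHomology N hℓ (add_mem hy hz)⟩ :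
        periodHomology N) = ⟨_, dualMap_heckeT_mem_periodHomology N hℓ hy⟩ + ⟨_, dualMap_heckeT_mem_periodHomology N hℓ hz⟩ :=
      Subtype.ext (map_add _ _ _)
    rw [h0, map_add, ihy, ihz, ← smul_add, ← map_add]
    rfl
  | neg y hy ih =>
    have h0 : (⟨(heckeT (Gamma0 N) 2 ℓ).dualMap (-y), dualMap_heckeT_mem_periodHomology N hℓ (neg_mem hy)⟩ :
        periodHomology N) = -⟨_, dualMap_heckeT_mem_periodHomology N hℓ hy⟩ :=
      Subtype.ext (map_neg _ _)
    rw [h0, map_neg, ih, ← smul_neg, ← map_neg]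
    rfl

/-! ## §3. Eisenstein-transparent operators -/

/- An operator `t ∈ End S₂(Γ₀(N))` is EISENSTEIN-TRANSPARENT for `φ` with multiplier `u ∈ ℤ` when `t^∨` preserves
`H₁(X₀(N), ℤ)` (`m : ∀ x ∈ periodHomology N, t.dualMap x ∈ periodHomology N`) and `φ(t^∨ x) = u·φ(x)` there
(`e : ∀ x hx, φ ⟨t.dualMap x, m x hx⟩ = u • φ ⟨x, hx⟩`); the producers below return the pair `⟨m, e⟩` as an existential. -/

include hφ hv in
/-- **`T_ℓ − c` is transparent with multiplier `ℓ + 1 − c`** (`ℓ ∤ N` prime, `c ∈ ℤ`; THEOREM A). [cite: Ribet1988Shimura, Thm. 1 and §3] -/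
theorem transparent_heckeT_sub {ℓ : ℕ} [NeZero ℓ] (hℓ : ℓ.Prime) (hℓN : ¬ ℓ ∣ N) (c : ℤ) :
    ∃ m : ∀ x ∈ periodHomology N, (heckeT (Gamma0 N) 2 ℓ - (c : ℂ) • 1).dualMap x ∈ periodHomology N,
      ∀ (x : Module.Dual ℂ (CuspForm (Gamma0 N) 2)) (hx : x ∈ periodHomology N),
        φ ⟨(heckeT (Gamma0 N) 2 ℓ - (c : ℂ) • 1).dualMap x, m x hx⟩ = ((ℓ : ℤ) + 1 - c) • φ ⟨x, hx⟩ := by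
  have e : ∀ x : Module.Dual ℂ (CuspForm (Gamma0 N) 2),
      (heckeT (Gamma0 N) 2 ℓ - (c : ℂ) • 1).dualMap x = (heckeT (Gamma0 N) 2 ℓ).dualMap x - c • x := by
    intro x
    rw [← Int.cast_smul_eq_zsmul ℂ c x]
    refine LinearMap.ext fun g ↦ ?_
    simp only [LinearMap.dualMap_apply, LinearMap.sub_apply, LinearMap.smul_apply, Module.End.one_apply, map_sub,
      map_smul]
  have hmem : ∀ x ∈ periodHomology N, (heckeT (Gamma0 N) 2 ℓ - (c : ℂ) • 1).dualMap x ∈ periodHomology N := by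
    intro x hx
    rw [e]
    exact sub_mem (dualMap_heckeT_mem_periodHomology N hℓ hx) (AddSubgroup.zsmul_mem _ hx c)
  refine ⟨hmem, fun x hx ↦ ?_⟩
  have h0 : (⟨(heckeT (Gamma0 N) 2 ℓ - (c : ℂ) • 1).dualMap x, hmem x hx⟩ : periodHomology N) =
      ⟨(heckeT (Gamma0 N) 2 ℓ).dualMap x, dualMap_heckeT_mem_periodHomology N hℓ hx⟩ - c • ⟨x, hx⟩ :=
    Subtype.ext (by rw [AddSubgroupClass.coe_sub, AddSubgroupClass.coe_zsmul]; exact e x)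
  rw [h0, map_sub, map_zsmul, value_dualMap_heckeT φ v hφ hv hℓ hℓN x hx, ← natCast_zsmul, Nat.cast_add, Nat.cast_one,
    sub_zsmul]
  all_goals abel

/-- **Transparency composes**, multipliers multiply. [folklore] -/
theorem transparent_comp {t₁ t₂ : Module.End ℂ (CuspForm (Gamma0 N) 2)} {u₁ u₂ : ℤ}
    (m₁ : ∀ x ∈ periodHomology N, t₁.dualMap x ∈ periodHomology N)
    (e₁ : ∀ (x : Module.Dual ℂ (CuspForm (Gamma0 N) 2)) (hx : x ∈ periodHomology N), φ ⟨t₁.dualMap x, m₁ x hx⟩ = u₁ • φ ⟨x, hx⟩)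
    (m₂ : ∀ x ∈ periodHomology N, t₂.dualMap x ∈ periodHomology N)
    (e₂ : ∀ (x : Module.Dual ℂ (CuspForm (Gamma0 N) 2)) (hx : x ∈ periodHomology N), φ ⟨t₂.dualMap x, m₂ x hx⟩ = u₂ • φ ⟨x, hx⟩) :
    ∃ m : ∀ x ∈ periodHomology N, (t₁ ∘ₗ t₂).dualMap x ∈ periodHomology N,
      ∀ (x : Module.Dual ℂ (CuspForm (Gamma0 N) 2)) (hx : x ∈ periodHomology N),
        φ ⟨(t₁ ∘ₗ t₂).dualMap x, m x hx⟩ = (u₂ * u₁) • φ ⟨x, hx⟩ := by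
  have hcomp : ∀ x : Module.Dual ℂ (CuspForm (Gamma0 N) 2), (t₁ ∘ₗ t₂).dualMap x = t₂.dualMap (t₁.dualMap x) :=
    fun x ↦ LinearMap.ext fun g ↦ rfl
  have m : ∀ x ∈ periodHomology N, (t₁ ∘ₗ t₂).dualMap x ∈ periodHomology N := fun x hx ↦ by
    rw [hcomp x]
    exact m₂ _ (m₁ x hx)
  refine ⟨m, fun x hx ↦ ?_⟩
  have h0 : (⟨(t₁ ∘ₗ t₂).dualMap x, m x hx⟩ : periodHomology N) = ⟨t₂.dualMap (t₁.dualMap x), m₂ _ (m₁ x hx)⟩ :=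
    Subtype.ext (hcomp x)
  rw [h0, e₂ _ (m₁ x hx), e₁ x hx, smul_smul]

/-! ## §4. THEOREM B: the separation criterion, and `¬ ShimuraIndexPrimeTo 2` -/

/-- **THEOREM B — SEPARATION.**  If a transparent `t` (multiplier `u` injective on `R`) SEPARATES `f` — `t·g ∈ ℂ·f` for every
`g ∈ S₂(Γ₀(N))` — then `φ` kills the period kernel of `f`: `x(f) = 0 ⇒ φ(x) = 0` (indeed `t^∨x = 0`, so `u·φ(x) = φ(t^∨x) = 0`).
[cite: Mazur1977, §II.9–II.11] -/
theorem ker_of_transparent_separator (f : CuspForm (Gamma0 N) 2) {t : Module.End ℂ (CuspForm (Gamma0 N) 2)} {u : ℤ}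
    (m : ∀ x ∈ periodHomology N, t.dualMap x ∈ periodHomology N)
    (e : ∀ (x : Module.Dual ℂ (CuspForm (Gamma0 N) 2)) (hx : x ∈ periodHomology N), φ ⟨t.dualMap x, m x hx⟩ = u • φ ⟨x, hx⟩)
    (hu : ∀ r : R, u • r = 0 → r = 0) (hsep : ∀ g : CuspForm (Gamma0 N) 2, ∃ c : ℂ, t g = c • f)
    (x : periodHomology N) (hx : (x : Module.Dual ℂ (CuspForm (Gamma0 N) 2)) f = 0) : φ x = 0 := by
  have h0 : t.dualMap (x : Module.Dual ℂ (CuspForm (Gamma0 N) 2)) = 0 := LinearMap.ext fun g ↦ by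
    obtain ⟨c, hc⟩ := hsep g
    rw [LinearMap.dualMap_apply, hc, map_smul, hx, smul_zero, LinearMap.zero_apply]
  have h1 := e x x.2
  have h2 : (⟨t.dualMap (x : Module.Dual ℂ (CuspForm (Gamma0 N) 2)), m _ x.2⟩ : periodHomology N) = 0 := Subtype.ext h0
  rw [h2, map_zero] at h1
  exact hu _ h1.symm

include hφ hv in
/-- **`n·v(γ) ≠ 0 ⇒ n·{∞, γ∞}_f ∉ Λ₁(f)` whenever a transparent separator for `f` exists** (THEOREM B + the period-kernel descent
of `…ShimuraTrivialThirtySix` §3). [cite: Mazur1977, §II.11] -/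
theorem zsmul_cuspSymbol_not_mem_of_transparent_separator (f : CuspForm (Gamma0 N) 2)
    {t : Module.End ℂ (CuspForm (Gamma0 N) 2)} {u : ℤ} (m : ∀ x ∈ periodHomology N, t.dualMap x ∈ periodHomology N)
    (e : ∀ (x : Module.Dual ℂ (CuspForm (Gamma0 N) 2)) (hx : x ∈ periodHomology N), φ ⟨t.dualMap x, m x hx⟩ = u • φ ⟨x, hx⟩)
    (hu : ∀ r : R, u • r = 0 → r = 0) (hsep : ∀ g : CuspForm (Gamma0 N) 2, ∃ c : ℂ, t g = c • f) (γ : Gamma0 N) (n : ℤ) (hγ : n • v γ ≠ 0) :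
    (n : ℂ) * cuspSymbol f γ ∉ periodLatticeGamma1 f :=
  zsmul_cuspSymbol_not_mem_of_hom_of_ker φ v hφ hv f (ker_of_transparent_separator φ f m e hu hsep) γ n hγ

include hφ hv in
/-- **`¬ ShimuraIndexPrimeTo 2 f` from a transparent separator, a class value `v(γ) ≠ 0` and `2Λ₀(f) ⊆ Λ₁(f)`.**
[cite: LingOesterle1991, §1 and Thm. 1] -/
theorem not_shimuraIndexPrimeTo_two_of_transparent_separator (f : CuspForm (Gamma0 N) 2)
    {t : Module.End ℂ (CuspForm (Gamma0 N) 2)} {u : ℤ} (m : ∀ x ∈ periodHomology N, t.dualMap x ∈ periodHomology N)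
    (e : ∀ (x : Module.Dual ℂ (CuspForm (Gamma0 N) 2)) (hx : x ∈ periodHomology N), φ ⟨t.dualMap x, m x hx⟩ = u • φ ⟨x, hx⟩)
    (hu : ∀ r : R, u • r = 0 → r = 0) (hsep : ∀ g : CuspForm (Gamma0 N) 2, ∃ c : ℂ, t g = c • f) (γ : Gamma0 N) (hγ : v γ ≠ 0)
    (h2 : ∀ z ∈ periodLattice f, (2 : ℂ) * z ∈ periodLatticeGamma1 f) : ¬ ShimuraIndexPrimeTo 2 f := by
  intro h
  have hmem := h _ (cuspSymbol_mem_periodLattice f γ) (by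
    rw [show ((2 : ℕ) : ℂ) = 2 by norm_num]
    exact h2 _ (cuspSymbol_mem_periodLattice f γ))
  have := zsmul_cuspSymbol_not_mem_of_transparent_separator φ v hφ hv f m e hu hsep γ 1 (by rwa [one_zsmul])
  rw [Int.cast_one, one_mul] at this
  exact this hmem

include hφ hv in
/-- **`¬ ShimuraIndexPrimeTo 2 D.f` for an `X₀(N)`-datum at `4 ∣ N`** from a transparent separator and a class value `v(γ) ≠ 0`
(`2Λ₀ ⊆ Λ₁` is the tree's `two_mul_mem_periodLatticeGamma1_of_four_dvd`). [cite: LingOesterle1991, Thm. 1 and Thm. 6] -/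
theorem not_shimuraIndexPrimeTo_two_of_data {W : WeierstrassCurve ℚ} [W.IsElliptic] (h4 : 2 ^ 2 ∣ N)
    (D : ModularParametrizationData W N) {t : Module.End ℂ (CuspForm (Gamma0 N) 2)} {u : ℤ}
    (m : ∀ x ∈ periodHomology N, t.dualMap x ∈ periodHomology N)
    (e : ∀ (x : Module.Dual ℂ (CuspForm (Gamma0 N) 2)) (hx : x ∈ periodHomology N), φ ⟨t.dualMap x, m x hx⟩ = u • φ ⟨x, hx⟩)
    (hu : ∀ r : R, u • r = 0 → r = 0) (hsep : ∀ g : CuspForm (Gamma0 N) 2, ∃ c : ℂ, t g = c • D.f) (γ : Gamma0 N)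
    (hγ : v γ ≠ 0) : ¬ ShimuraIndexPrimeTo 2 D.f :=
  not_shimuraIndexPrimeTo_two_of_transparent_separator φ v hφ hv D.f m e hu hsep γ hγ
    fun _ hz ↦ two_mul_mem_periodLatticeGamma1_of_four_dvd D h4 hz

end Summit.BirchSwinnertonDyer.BirchSwinnertonDyer.Theorems.ManinLocalTwoThree.ShimuraEisenstein
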